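import Summits.QuantumFields.BalabanUV.Beta.EriceRemainderEnclosureHistoryAutonomyComparisonDampedWindow

/-!
# EriceRemainderEnclosureHistoryAutonomyComparisonDampedBudget — (E70f) COMPARISON UNDER THE DAMPED BUDGET: `B = b + Σ_{k<K} L_k·u_k` (ANY ages, sizes,
# Markov weight), `B′ ≥ B` with isotone excess BOUNDED by `η̄` on the box; if along EVERY base solution `g` from every pin the damped windows
# `T_{l+1} = (T_l + 1)∕(1 + s₀·φ_{l+1}(g))` (`φ_{l+1}(g) = Σ_k L_k g_{l+1+k}³ √((2l+3)∕(2(l+1+k)+1))`, `s₀ = ρ²∕(1+ρ)`, `ρ²(1 + η̄∕b) ≤ 1`) satisfy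
# **`Σ_k L_k·(g_k³∕2)·T_k ≤ 1`**, then ANY box solutions from one pin satisfy `h′ ≤ h` at EVERY scale — (E58b)'s profile condition with DAMPED windows
# ((E70e) THE STEP ∘ (E63a) the principle); the first END of route (R-a)

Cell `pub-balaban`, β-function sub-cell, BINDER row D4 «RemainderConst leaves for Bałaban's split» (`HOME/BINDER-OWNERS.md`; owner lineage `b2b-balaban-beta-an4`;
this file by co-owner #2 lineage `b2b-balaban-beta-d4-p2`, generation 60), β-FLOW TEAM duty (1), FREEZE (0) honoured (def-free; (E70e)'s
`levelGap_le_damped_window` ∕ `effective_le_of_family_le_at_damped_window`, (E63a)'s `le_of_isotone_excess_of_step_below`, (E64a)'s `sq_div_one_add_mono`,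
(E48a)'s `le_of_pin_le` ∕ `memFlow_tail`, node U2's `invSq_eq_of_memFlow` ∕ `mul_lower_le_drive`, (E41)'s `affine_monotone` ∕ `affine_floor` ∕ `affine_zerothMoment`
BY NAME; nothing restated).

HONEST FRAMING (page 1, verbatim and binding).  *"Discharging BetaPertH makes Bałaban's UV stability UNCONDITIONAL — a real constructive-QFT result; it is
NOT the continuum limit and NOT the Clay problem."*  THIS FILE DISCHARGES NOTHING OF THE KIND.  Elementary real analysis about ABSTRACT affine functionals on a
box ]0,γ]^ℕ with displayed floors, profiles and signs — hypotheses of a census, not facts; the form, signs, ages and moments of Bałaban's (1.22) limit functional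
are NOT PRINTED ([I] p. 298; GAPS G-t4-U2-1∕-2) and NOT asserted.  Row D4 class UNCHANGED (critical-path width 0; instance 0∕1; D4 DISCHARGE NO DATE).  HONEST
DEPENDENCY: continuum YM on T⁴ ⇐ BetaPertH ∧ nine spine estimates (0/9 proved); BetaPertH ⇐ (D1) ∧ (D4) ∧ CAP+tail; G-an2-4 gates asym, D1 and NE2/3/4.

THE POINT (census sense (α); the COMPARISON column, conjecture (E58′); route (R-a) of `HOME/b2b-balaban-beta-d4-p2/g60/e70/README.md`).  (E70e) proved THE STEP
under `Σ_k L_k(h_k³∕2)T_k ≤ 1` with the shape factor `s = r²∕(1+r)`, `r = h′_{l+1}∕h_{l+1}`, read off the comparison configuration.  Here the shape factor is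
bounded BELOW through the size of the excess: `r² = 1∕(1 + h_{l+1}²D_{l+1})`, `D_{l+1} ≤ (l+1)η` ((E70e) with `T_k = k`), `h_{l+1}² ≤ 1∕((l+1)b)` — so
`r² ≥ 1∕(1 + η̄∕b)` whenever the excess is at most `η̄` on the box, and `s ≥ s₀ = ρ²∕(1+ρ)` for any `ρ > 0` with `ρ²(1 + η̄∕b) ≤ 1`.  The damped windows
with `s₀` are functionals of the BASE trajectory alone, and (E63a)'s principle turns the STEP into comparison from every pin.  At first order (`η̄ → 0`,
`ρ → 1`, `s₀ → ½`) the hypothesis is the Λ-criterion of the README (numerically `Λ ≤ 0.72` on every simulated profile — towers, clusters, two far ages — where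
(E58b)'s `Q∕2` is the total load `≤ 0.84`); the size enters only through `s₀`.  NOT CLAIMED: that the damped budget holds for every profile (astronomically
separated towers add `≈ 0.75 × 0.68` per decoupled age); anything printed.

WHAT IS PROVED ([folklore]; 0 `def`, 0 sorry).  `ratio_sq_ge` (the shape factor from the size of the excess), **`le_of_isotone_excess_of_damped_budget`** (END).
-/
noncomputable section
open Finset Set

namespace Summit.QuantumFields.BalabanUV.Beta.EriceRemainderEnclosureHistoryAutonomyComparisonDampedBudget

open Literature.MathematicalPhysics.QuantumFieldTheory.Balaban1983to89
open Literature.MathematicalPhysics.QuantumFieldTheory.Balaban1983to89.T4BetaStationary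
open Literature.MathematicalPhysics.QuantumFieldTheory.Balaban1983to89.T4BetaFlowWellPosed
open Summit.QuantumFields.BalabanUV.Beta.EriceRemainderEnclosureHistoryAutonomyOrder (strictAnti_of_memFlow memFlow_tail le_of_pin_le)
open Summit.QuantumFields.BalabanUV.Beta.EriceRemainderEnclosureHistoryAutonomyComparisonDropBound (le_of_isotone_excess_of_step_below)
open Summit.QuantumFields.BalabanUV.Beta.EriceRemainderEnclosureHistoryAutonomyComparisonGapPersistence (sq_div_one_add_mono)
open Summit.QuantumFields.BalabanUV.Beta.EriceRemainderEnclosureHistoryAutonomyComparisonDampedWindow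
  (levelGap_le_damped_window effective_le_of_family_le_at_damped_window)
open Summit.QuantumFields.BalabanUV.Beta.EriceRemainderEnclosureHistoryAutonomyMonotone (affine_monotone affine_floor affine_zerothMoment)

variable {B' : (ℕ → ℝ) → ℝ} {M' γ b : ℝ} {L : ℕ → ℝ} {K : ℕ} {h h' : ℕ → ℝ}

/-- The shape factor from the size of the excess: for `0 < x′ ≤ x` with `x²·(1∕x′² − 1∕x²) ≤ c` and `ρ > 0`, `ρ²(1 + c) ≤ 1`: `ρ ≤ x′∕x`
(`(x′∕x)² = 1∕(1 + x²(1∕x′² − 1∕x²))`). [folklore] -/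
theorem ratio_sq_ge {x x' c ρ : ℝ} (hx : 0 < x) (hx' : 0 < x') (hle : x' ≤ x) (hc : x ^ 2 * (1 / x' ^ 2 - 1 / x ^ 2) ≤ c)
    (hρ : 0 < ρ) (hρc : ρ ^ 2 * (1 + c) ≤ 1) : ρ ≤ x' / x := by
  have hr0 : 0 < x' / x := div_pos hx' hx
  have e : (x' / x) ^ 2 * (1 + x ^ 2 * (1 / x' ^ 2 - 1 / x ^ 2)) = 1 := by field_simp; ring
  have hD : 0 ≤ x ^ 2 * (1 / x' ^ 2 - 1 / x ^ 2) :=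
    mul_nonneg (sq_nonneg x) (sub_nonneg.2 (one_div_le_one_div_of_le (pow_pos hx' 2) (pow_le_pow_left₀ hx'.le hle 2)))
  have hsq : ρ ^ 2 ≤ (x' / x) ^ 2 := by nlinarith [e, hD, sq_nonneg ρ, sq_nonneg (x' / x)]
  exact (pow_le_pow_iff_left₀ hρ.le hr0.le two_ne_zero).mp hsq

/-- **COMPARISON UNDER THE DAMPED BUDGET.**  `B(u) = b + Σ_{k<K} L_k·u_k` on ]0,γ] (`b > 0`, `L ≥ 0` of ANY sizes, ages, Markov weight); `B′ ≥ B` with a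
zeroth moment `M′ ≥ 0`, an ISOTONE excess, and the excess BOUNDED by `η̄` on the box; `ρ > 0` with `ρ²(1 + η̄∕b) ≤ 1` and `s₀ = ρ²∕(1+ρ)`.  Suppose THE DAMPED
BUDGET: along every box solution `g` of `B` from every pin `q ∈ ]0,γ]` there is `T` with `T_0 = 0`, `T_l + 1 ≤ T_{l+1}·(1 + φ_{l+1}(g)·s₀)`
(`φ_{l+1}(g) = Σ_k L_k·g_{l+1+k}³·√((2l+3)∕(2(l+1+k)+1))`) and `Σ_k L_k·(g_k³∕2)·T_k ≤ 1`.  Then ANY box solutions `h`, `h′` of `B`, `B′` from one pin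
satisfy `h′ ≤ h` at EVERY scale — (E63a)'s principle with (E70e)'s STEP. [folklore] -/
theorem le_of_isotone_excess_of_damped_budget {p ρ ηbar : ℝ} (hL : ∀ k, 0 ≤ L k) (hb : 0 < b)
    (hB' : ∀ u u' : ℕ → ℝ, SeqBox γ u → SeqBox γ u' → ∀ D : ℝ, (∀ j, |u j - u' j| ≤ D) → |B' u - B' u'| ≤ M' * D) (hM' : 0 ≤ M')
    (hexc : ∀ u, SeqBox γ u → (fun u : ℕ → ℝ => b + ∑ k ∈ range K, L k * u k) u ≤ B' u)
    (hDmono : ∀ u v : ℕ → ℝ, SeqBox γ u → SeqBox γ v → (∀ j, u j ≤ v j) →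
      B' u - (fun u : ℕ → ℝ => b + ∑ k ∈ range K, L k * u k) u ≤ B' v - (fun u : ℕ → ℝ => b + ∑ k ∈ range K, L k * u k) v)
    (hexcle : ∀ u, SeqBox γ u → B' u - (fun u : ℕ → ℝ => b + ∑ k ∈ range K, L k * u k) u ≤ ηbar)
    (hρ : 0 < ρ) (hρη : ρ ^ 2 * (1 + ηbar / b) ≤ 1)
    (hbudget : ∀ (q : ℝ) (g : ℕ → ℝ), 0 < q → q ≤ γ → SeqBox γ g → MemFlow (fun u : ℕ → ℝ => b + ∑ k ∈ range K, L k * u k) q g →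
      ∃ T : ℕ → ℝ, T 0 = 0 ∧
        (∀ l : ℕ, T l + 1 ≤ T (l + 1) * (1 + (∑ k ∈ range K, L k * g (l + 1 + k) ^ 3 *
          Real.sqrt ((2 * ((l : ℝ) + 1) + 1) / (2 * (((l : ℝ) + 1) + k) + 1))) * (ρ ^ 2 / (1 + ρ)))) ∧
        ∑ k ∈ range K, L k * (g k ^ 3 / 2) * T k ≤ 1)
    (hp : 0 < p) (hpγ : p ≤ γ) (hh : SeqBox γ h) (hf : MemFlow (fun u : ℕ → ℝ => b + ∑ k ∈ range K, L k * u k) p h)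
    (hh' : SeqBox γ h') (hf' : MemFlow B' p h') (j : ℕ) : h' j ≤ h j := by
  set Bf : (ℕ → ℝ) → ℝ := fun u => b + ∑ k ∈ range K, L k * u k with hB_def
  have hmono : ∀ u v : ℕ → ℝ, SeqBox γ u → SeqBox γ v → (∀ j, u j ≤ v j) → Bf u ≤ Bf v := affine_monotone hL
  have hlo : ∀ u, SeqBox γ u → b ≤ Bf u := affine_floor hL
  have hlo' : ∀ u, SeqBox γ u → b ≤ B' u := fun u hu => (hlo u hu).trans (hexc u hu)
  have hB : ∀ u u' : ℕ → ℝ, SeqBox γ u → SeqBox γ u' → ∀ D : ℝ, (∀ j, |u j - u' j| ≤ D) → |Bf u - Bf u'| ≤ (∑ k ∈ range K, L k) * D :=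
    affine_zerothMoment hL
  have hM : 0 ≤ ∑ k ∈ range K, L k := sum_nonneg fun k _ => hL k
  have hηbar : 0 ≤ ηbar := by
    have hγ : 0 < γ := hp.trans_le hpγ
    have := hexcle (fun _ => γ) (fun _ => ⟨hγ, le_rfl⟩); have := hexc (fun _ => γ) (fun _ => ⟨hγ, le_rfl⟩); linarith
  refine le_of_isotone_excess_of_step_below (B := Bf) hmono hB hM hb hlo hB' hM' hexc hDmono ?_ hp hpγ hh hf hh' hf' j
  intro S S' hS huniq hS' huniq' y hy hyγ hdeep g g' hg hfg hg' hfg' hle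
  -- ordered pins give ordered base solutions
  have hpin : ∀ t t' : ℝ, ∀ u u' : ℕ → ℝ, 0 < t → t ≤ t' → t' ≤ γ → SeqBox γ u → SeqBox γ u' →
      MemFlow Bf t u → MemFlow Bf t' u' → ∀ j, u j ≤ u' j :=
    fun t t' u u' ht htt' ht'γ hu hu' hfu hfu' j => le_of_pin_le hb hB hM hlo huniq ht htt' ht'γ hu hu' hfu hfu' j
  -- the perturbed tails lie below the base solutions from their own pins (comparison one floor step deeper)
  have htail : ∀ l j, g' (l + 1 + j) ≤ S (g' (l + 1)) j := by
    intro l j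
    have hz := (hg' (l + 1)).1
    have hzγ := (hg' (l + 1)).2
    have hlev : 1 / y ^ 2 + b ≤ 1 / g' (l + 1) ^ 2 := by
      rw [invSq_eq_of_memFlow hfg' (l + 1)]
      have := mul_lower_le_drive hlo' hg' (l + 1)
      have hl1 : b ≤ ((l + 1 : ℕ) : ℝ) * b := by
        have : (1 : ℝ) ≤ ((l + 1 : ℕ) : ℝ) := by exact_mod_cast Nat.succ_le_succ (Nat.zero_le l)
        nlinarith
      linarith
    obtain ⟨_, hSle⟩ := hdeep (g' (l + 1)) hz hzγ hlev
    have htl : MemFlow B' (g' (l + 1)) (fun j => g' (l + 1 + j)) := memFlow_tail hfg' (l + 1)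
    have e : (fun j => g' (l + 1 + j)) = S' (g' (l + 1)) :=
      huniq' _ hz hzγ _ _ (seqBox_shift hg' (l + 1)) (hS' _ hz hzγ).1 htl (hS' _ hz hzγ).2
    have := hSle j
    rw [← e] at this
    exact this
  -- the damped windows of the base trajectory g from pin y
  obtain ⟨T, hT0, hT, hΛ⟩ := hbudget y g hy hyγ hg hfg
  -- excess at this pin
  set η : ℝ := B' g' - Bf g' with hη_def
  have hη0 : 0 ≤ η := by rw [hη_def]; linarith [hexc g' hg']
  have hηle : η ≤ ηbar := hexcle g' hg'
  -- first pass with T_k = k: D_l ≤ l·η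
  have hlin : ∀ l : ℕ, 1 / g' l ^ 2 - 1 / g l ^ 2 ≤ η * l := by
    intro l
    have := levelGap_le_damped_window (T := fun n => (n : ℝ)) hL hb hexc hDmono hpin hS hy hg hfg hg' hfg' hle htail
      (by simp) (fun n => by
        have hφ : 0 ≤ (∑ k ∈ range K, L k * g (n + 1 + k) ^ 3 * Real.sqrt ((2 * ((n : ℝ) + 1) + 1) / (2 * (((n : ℝ) + 1) + k) + 1))) :=
          sum_nonneg fun k _ => mul_nonneg (mul_nonneg (hL k) (pow_nonneg (hg (n + 1 + k)).1.le 3)) (Real.sqrt_nonneg _)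
        have hs : 0 ≤ (g' (n + 1) / g (n + 1)) ^ 2 / (1 + g' (n + 1) / g (n + 1)) := by
          have := (hg' (n + 1)).1; have := (hg (n + 1)).1; positivity
        push_cast
        nlinarith [mul_nonneg hφ hs]) l
    simpa [hη_def, hB_def, mul_comm] using this
  -- the shape factor s_{l+1} ≥ s₀
  have hshape : ∀ l : ℕ, ρ ^ 2 / (1 + ρ) ≤ (g' (l + 1) / g (l + 1)) ^ 2 / (1 + g' (l + 1) / g (l + 1)) := by
    intro l
    have hx := (hg (l + 1)).1
    have hx' := (hg' (l + 1)).1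
    -- g(l+1)² D_{l+1} ≤ η̄/b
    have hc : g (l + 1) ^ 2 * (1 / g' (l + 1) ^ 2 - 1 / g (l + 1) ^ 2) ≤ ηbar / b := by
      have hD := hlin (l + 1)
      have hlev : ((l + 1 : ℕ) : ℝ) * b ≤ 1 / g (l + 1) ^ 2 := by
        rw [invSq_eq_of_memFlow hfg (l + 1)]
        have := mul_lower_le_drive hlo hg (l + 1)
        have : 0 ≤ 1 / y ^ 2 := by positivity
        linarith
      have hl1 : (0 : ℝ) < ((l + 1 : ℕ) : ℝ) := by positivity
      -- g² ≤ 1/((l+1) b)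
      have hg2 : g (l + 1) ^ 2 ≤ 1 / (((l + 1 : ℕ) : ℝ) * b) := by
        rw [le_div_iff₀ (by positivity)]
        have := mul_le_mul_of_nonneg_left hlev (sq_nonneg (g (l + 1)))
        have e : g (l + 1) ^ 2 * (1 / g (l + 1) ^ 2) = 1 := by field_simp
        nlinarith [this, e]
      have hDnn : 0 ≤ 1 / g' (l + 1) ^ 2 - 1 / g (l + 1) ^ 2 :=
        sub_nonneg.2 (one_div_le_one_div_of_le (pow_pos hx' 2) (pow_le_pow_left₀ hx'.le (hle (l + 1)) 2))
      calc g (l + 1) ^ 2 * (1 / g' (l + 1) ^ 2 - 1 / g (l + 1) ^ 2)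
          ≤ (1 / (((l + 1 : ℕ) : ℝ) * b)) * (η * ((l + 1 : ℕ) : ℝ)) := mul_le_mul hg2 hD hDnn (by positivity)
        _ = η / b := by field_simp
        _ ≤ ηbar / b := div_le_div_of_nonneg_right hηle hb.le
    have hr := ratio_sq_ge hx hx' (hle (l + 1)) hc hρ hρη
    exact sq_div_one_add_mono hρ.le hr
  -- the damped windows satisfy (E70e)'s hypothesis with the true shape factor
  have hTnn : ∀ k, 0 ≤ T k := by
    intro k
    induction k with
    | zero => rw [hT0]
    | succ k ihk =>
      have hTk := hT k
      have hφ0 : 0 ≤ ∑ k' ∈ range K, L k' * g (k + 1 + k') ^ 3 * Real.sqrt ((2 * ((k : ℝ) + 1) + 1) / (2 * (((k : ℝ) + 1) + k') + 1)) :=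
        sum_nonneg fun k' _ => mul_nonneg (mul_nonneg (hL k') (pow_nonneg (hg (k + 1 + k')).1.le 3)) (Real.sqrt_nonneg _)
      have hs0 : 0 ≤ ρ ^ 2 / (1 + ρ) := by positivity
      have hpos : 0 < 1 + (∑ k' ∈ range K, L k' * g (k + 1 + k') ^ 3 * Real.sqrt ((2 * ((k : ℝ) + 1) + 1) / (2 * (((k : ℝ) + 1) + k') + 1))) *
          (ρ ^ 2 / (1 + ρ)) := by nlinarith [mul_nonneg hφ0 hs0]
      by_contra hneg
      rw [not_le] at hneg
      have := mul_neg_of_neg_of_pos hneg hpos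
      linarith
  have hT' : ∀ l : ℕ, T l + 1 ≤ T (l + 1) * (1 + (∑ k ∈ range K, L k * g (l + 1 + k) ^ 3 *
      Real.sqrt ((2 * ((l : ℝ) + 1) + 1) / (2 * (((l : ℝ) + 1) + k) + 1))) * ((g' (l + 1) / g (l + 1)) ^ 2 / (1 + g' (l + 1) / g (l + 1)))) := by
    intro l
    have hφ0 : 0 ≤ ∑ k ∈ range K, L k * g (l + 1 + k) ^ 3 * Real.sqrt ((2 * ((l : ℝ) + 1) + 1) / (2 * (((l : ℝ) + 1) + k) + 1)) :=
      sum_nonneg fun k _ => mul_nonneg (mul_nonneg (hL k) (pow_nonneg (hg (l + 1 + k)).1.le 3)) (Real.sqrt_nonneg _)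
    have h1 := hT l
    have h2 : T (l + 1) * (1 + (∑ k ∈ range K, L k * g (l + 1 + k) ^ 3 *
        Real.sqrt ((2 * ((l : ℝ) + 1) + 1) / (2 * (((l : ℝ) + 1) + k) + 1))) * (ρ ^ 2 / (1 + ρ))) ≤
        T (l + 1) * (1 + (∑ k ∈ range K, L k * g (l + 1 + k) ^ 3 *
        Real.sqrt ((2 * ((l : ℝ) + 1) + 1) / (2 * (((l : ℝ) + 1) + k) + 1))) * ((g' (l + 1) / g (l + 1)) ^ 2 / (1 + g' (l + 1) / g (l + 1)))) :=
      mul_le_mul_of_nonneg_left (by nlinarith [mul_le_mul_of_nonneg_left (hshape l) hφ0]) (hTnn (l + 1))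
    exact h1.trans h2
  exact effective_le_of_family_le_at_damped_window hL hb hexc hDmono hpin hS hy hg hfg hg' hfg' hle htail hT0 hT' hΛ

end Summit.QuantumFields.BalabanUV.Beta.EriceRemainderEnclosureHistoryAutonomyComparisonDampedBudget

end
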